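import Summits.BirchSwinnertonDyer.BirchSwinnertonDyer.Theorems.TorsionLayerDescentAssembly
import Summits.BirchSwinnertonDyer.Rank1Residual.X9.LightFrameSupplyOddOfFriedbergHoffstein
import HarnessLib

/-!
# Route `TorsionLayerDescent` with its frame-supply item F DISCHARGED to print: the support item
# `LightFrameSupplyOdd` (stmt-BirchSwinnertonDyer-23163) BY NAME from published named facts, and the
# K6 leaf `BSDpOnClassX9` from the route's cruxes A, B, engine E and print conjunction D plus ONE
# cite-only fact (Friedberg–Hoffstein 1995 Thm. B (1), or Hoffstein–Luo 1997 = PrintX9's aside item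
# 19372 up to δ) — i.e. the route's ASSEMBLY (item 23166, proved p583666) with `hF` eliminated

HONEST FRAMING (cell `run/shared/lean/pub/bsd-print-x9/`, D-0131 print tier; typer seat ty3, serving
the TorsionLayerDescent pen's open hand «the closing file [for F] to whoever sits first»,
`pub/bsd-print-x9/INBOX.md` 2026-08-27T23:10:36Z (P1); LEAF file of the typer tree `Rank1Residual/X9/`
— it imports the route's landed assembly `Theorems/TorsionLayerDescentAssembly.lean`, hence the route
file `Theses/TorsionLayerDescent.lean`, to conclude the item decl BY NAME; the route-free statements are
in the companion `X9/LightFrameSupplyOddOfFriedbergHoffstein.lean`, p589032). THEOREMS ONLY: no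
definition, no named fact, no `sorry`; nothing booked, nothing closed (the item stays open on the
ledger until its two cite-only inputs are theorems; the proof is attached as evidence on item 23163).
After this file the route's OPEN inputs to the leaf are exactly: crux A `HowardContainmentAnyClassNumber`
(23161), crux B `TwoSidedLinkAnyClassNumber` (23162), engine E `EngineIMCX9` (23164 :=
`IntegralMainConjectureOnClassX9`, K6, open problem), the print conjunction D `DescentPrintFacts`
(23165, cite-only) and ONE cite-only non-vanishing fact — F is no longer an input.
«beyond-print theorem»: NO. BSD is not proved by any of this; no leaf closes (A, B, E open).

WHAT.
* §1 `lightFrameSupplyOdd_of_namedFacts (hnf) (hFH) : LightFrameSupplyOdd` (item 23163 BY NAME; FH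
  1995 Thm. B (1) finite-set form `friedbergHoffstein_exists_heegnerField_splitDivisors_twist_ne_zero`
  + modularity `exists_isNewformOf`); `…_of_namedFacts_hoffsteinLuo (hnf) (hHL)`;
  `…_of_descentPrintFacts_of_friedbergHoffstein (hD) (hFH)` (modularity is conjunct 8 of D). Up to
  δ-unfolding `hnf` / `hHL` ARE the PrintX9 route's aside items `Theses.PrintX9.NewformExistence`
  (stmt-BirchSwinnertonDyer-19382 := `exists_isNewformOf`) / `Theses.PrintX9.HoffsteinLuoTwistNonvanishing`
  (stmt-BirchSwinnertonDyer-19372 := `HoffsteinLuo1997_exists_twist_L_one_ne_zero`) — so for the PrintX9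
  pen's odd-`d_K` reshape (PLAN §7(g)) the light frame supply costs that route NO new item
  (`lightFrameSupplyOdd_of_hoffsteinLuo h19382 h19372` typechecks; `Theses/PrintX9.lean` is not imported
  here to keep one route file per leaf).
* §2 `bsdpOnClassX9_of_cruxes_of_descentPrintFacts_of_friedbergHoffstein (hA) (hB) (hE) (hD) (hFH) :
  Rank1Residual.BSDpOnClassX9` and `…_of_hoffsteinLuo (hA) (hB) (hE) (hD) (hHL)` — the route's
  assembly `TorsionLayer.torsionLayerDescent_assembly` with `hF` fed by §1.

References: [FriedbergHoffstein1995] Thm. B (1); [JetchevSkinnerWan2017] §7.4.1–7.4.2;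
[HoffsteinLuo1997] Theorem (§1, pp. 435–436); [BCDTJAMS2001] Thm. A; route files
`Theses/TorsionLayerDescent.lean` (rev 0: items 23161–23166; imported through the assembly) and
`Theses/PrintX9.lean` (rev 7: asides 19372, 19382; text only, not imported).
-/

-- the summit namespace `Summit.BirchSwinnertonDyer.BirchSwinnertonDyer.…` repeats the summit name
set_option linter.dupNamespace false
set_option autoImplicit false

noncomputable section

open Literature.NumberTheory.EllipticCurves Literature.NumberTheory.EllipticCurves.ModularForms

open Summit.BirchSwinnertonDyer.BirchSwinnertonDyer.Theses.TorsionLayerDescent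
  (HowardContainmentAnyClassNumber TwoSidedLinkAnyClassNumber LightFrameSupplyOdd EngineIMCX9
    DescentPrintFacts)

namespace Summit.BirchSwinnertonDyer.BirchSwinnertonDyer.Rank1Residual

namespace TorsionLayer

/-! ### §1 Item F = `LightFrameSupplyOdd` (stmt-BirchSwinnertonDyer-23163) BY NAME from print -/

/-- **Item 23163 `LightFrameSupplyOdd` from Friedberg–Hoffstein 1995 Thm. B (1) and modularity.**
[cite: FriedbergHoffstein1995, Thm. B (1) (as applied in JetchevSkinnerWan2017 §7.4.1 p. 30, §7.4.2 p. 31)]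
[cite: BCDTJAMS2001, Thm. A] -/
theorem lightFrameSupplyOdd_of_namedFacts (hnf : exists_isNewformOf)
    (hFH : friedbergHoffstein_exists_heegnerField_splitDivisors_twist_ne_zero) :
    LightFrameSupplyOdd :=
  lightFrameSupplyOdd_of_friedbergHoffstein hnf hFH

/-- **Item 23163 `LightFrameSupplyOdd` from Hoffstein–Luo 1997 and modularity.**
[cite: HoffsteinLuo1997, Theorem (§1, pp. 435–436)] [cite: BCDTJAMS2001, Thm. A] -/
theorem lightFrameSupplyOdd_of_namedFacts_hoffsteinLuo (hnf : exists_isNewformOf)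
    (hHL : HoffsteinLuo1997_exists_twist_L_one_ne_zero) : LightFrameSupplyOdd :=
  lightFrameSupplyOdd_of_hoffsteinLuo hnf hHL

/-- **Item 23163 from the route's own print conjunction D (item 23165, whose conjunct 8 is
modularity) and Friedberg–Hoffstein.** [cite: FriedbergHoffstein1995, Thm. B (1)] -/
theorem lightFrameSupplyOdd_of_descentPrintFacts_of_friedbergHoffstein (hD : DescentPrintFacts)
    (hFH : friedbergHoffstein_exists_heegnerField_splitDivisors_twist_ne_zero) :
    LightFrameSupplyOdd :=
  lightFrameSupplyOdd_of_friedbergHoffstein hD.2.2.2.2.2.2.2.1 hFH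

/-! ### §2 The route's leaf door with F eliminated -/

/-- **`BSDpOnClassX9` from cruxes A, B, engine E, print D and Friedberg–Hoffstein** — the route's
assembly (item 23166, `torsionLayerDescent_assembly`) with its frame-supply hypothesis `hF` discharged
by §1. Open inputs: A (23161), B (23162), E (23164, K6 open problem); cite-only: D (23165), `hFH`.
[cite: FriedbergHoffstein1995, Thm. B (1)] [cite: JetchevSkinnerWan2017, Thm. 3.3.1 and §7.4.1–7.4.2] -/
theorem bsdpOnClassX9_of_cruxes_of_descentPrintFacts_of_friedbergHoffstein
    (hA : HowardContainmentAnyClassNumber) (hB : TwoSidedLinkAnyClassNumber) (hE : EngineIMCX9)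
    (hD : DescentPrintFacts)
    (hFH : friedbergHoffstein_exists_heegnerField_splitDivisors_twist_ne_zero) :
    Summit.BirchSwinnertonDyer.BirchSwinnertonDyer.Rank1Residual.BSDpOnClassX9 :=
  torsionLayerDescent_assembly hA hB
    (lightFrameSupplyOdd_of_descentPrintFacts_of_friedbergHoffstein hD hFH) hE hD

/-- **`BSDpOnClassX9` from cruxes A, B, engine E, print D and Hoffstein–Luo** — the same door on the
Hoffstein–Luo root; `hnf`/`hHL` are, up to δ-unfolding, the PrintX9 route's aside items
`Theses.PrintX9.NewformExistence` (stmt-BirchSwinnertonDyer-19382) / `Theses.PrintX9.HoffsteinLuoTwistNonvanishing`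
(stmt-BirchSwinnertonDyer-19372), so on the union of the two routes' ledgers every hypothesis here is an
item by name. [cite: HoffsteinLuo1997, Theorem (§1, pp. 435–436)] -/
theorem bsdpOnClassX9_of_cruxes_of_descentPrintFacts_of_hoffsteinLuo
    (hA : HowardContainmentAnyClassNumber) (hB : TwoSidedLinkAnyClassNumber) (hE : EngineIMCX9)
    (hD : DescentPrintFacts) (hHL : HoffsteinLuo1997_exists_twist_L_one_ne_zero) :
    Summit.BirchSwinnertonDyer.BirchSwinnertonDyer.Rank1Residual.BSDpOnClassX9 :=
  torsionLayerDescent_assembly hA hB (lightFrameSupplyOdd_of_hoffsteinLuo hD.2.2.2.2.2.2.2.1 hHL)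
    hE hD

end TorsionLayer

end Summit.BirchSwinnertonDyer.BirchSwinnertonDyer.Rank1Residual

end
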